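import Summits.QuantumFields.YangMills.Theorems.F4SubCurvatureDoorHexagonPolynomial
import Mathlib
import HarnessLib

/-!
# Hexagon normal form — no POLYNOMIAL pair passes the hexagon Wick test, case `deg F > deg G + 3`

Support lemma toward the OPEN finite-type hexagon conjecture behind crux `stmt-QuantumFields-23125`
(`F4SubCurvatureDoor.RationalToGeneral`), continuing `F4SubCurvatureDoorHexagonPolynomial.lean` (rescaling principle
`rescaled_roots_mem`, case `deg F < deg G + 3`).

* `exists_nonreal_pow_eq` — for `m ≥ 3` and real `κ ≠ 0` there is a NON-REAL complex `w` with `w^m = κ`;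
* `hexagonPencil_noPoly_gt` — CASE `deg F > deg G + 3` (`m = deg F − deg G ≥ 4`): rescaling `z = t³ w`, `s = t^m` (`t = n + 1`) the
  pencil `Φ_s = F + P_s G` tends coefficientwise to `lc(F) w^f − 32 lc(G) w^g = w^g (lc(F) w^m − 32 lc(G))`, which has a non-real root,
  while all rescaled roots are real — so `WickHexagon F G` fails for every such real polynomial pair with `G ≠ 0`.

Mathlib + tree helpers only; THEOREMS ONLY; no `sorry`; default heartbeats.  Nothing about crux 23125, crux 23035, any LADDER-YM
rung or the Yang–Mills mass gap is proved here.  Free-hands seat `ym-line-frs-p2` g10, `--supports stmt-QuantumFields-23125`.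
-/

set_option autoImplicit false

open Filter Topology Polynomial

namespace Summit.QuantumFields.YangMills.Cruxes.RationalToGeneral.HexagonNormalForm

/-- For `m ≥ 3` and a non-zero real `κ`, some NON-REAL complex number has `m`-th power `κ`. [folklore] -/
theorem exists_nonreal_pow_eq (m : ℕ) (hm : 3 ≤ m) (κ : ℝ) (hκ : κ ≠ 0) : ∃ w : ℂ, w ^ m = (κ : ℂ) ∧ w.im ≠ 0 := by
  obtain ⟨w₀, hw₀⟩ := IsAlgClosed.exists_pow_nat_eq (κ : ℂ) (by omega : 0 < m)
  by_cases h0 : w₀.im ≠ 0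
  · exact ⟨w₀, hw₀, h0⟩
  rw [not_not] at h0
  -- rotate the real root by `2π/m`
  have hw₀re : w₀ = ((w₀.re : ℝ) : ℂ) := by
    apply Complex.ext <;> simp [h0]
  have hre0 : w₀.re ≠ 0 := by
    intro h
    have : w₀ = 0 := by rw [hw₀re, h, Complex.ofReal_zero]
    rw [this, zero_pow (by omega)] at hw₀
    exact hκ (Complex.ofReal_eq_zero.1 hw₀.symm)
  set θ : ℝ := 2 * Real.pi / m with hθ
  have hmpos : (0 : ℝ) < m := by exact_mod_cast (by omega : 0 < m)
  have hζm : Complex.exp ((θ : ℂ) * Complex.I) ^ m = 1 := by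
    rw [← Complex.exp_nat_mul, hθ]
    have hmC : (m : ℂ) ≠ 0 := by exact_mod_cast (by omega : m ≠ 0)
    have : (m : ℂ) * (((2 * Real.pi / m : ℝ) : ℂ) * Complex.I) = 2 * Real.pi * Complex.I := by
      push_cast
      field_simp
    rw [this, Complex.exp_two_pi_mul_I]
  have hsin : 0 < Real.sin θ := by
    apply Real.sin_pos_of_pos_of_lt_pi
    · rw [hθ]; positivity
    · rw [hθ, div_lt_iff₀ hmpos]
      have h3 : (3 : ℝ) ≤ m := by exact_mod_cast hm
      nlinarith [Real.pi_pos]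
  refine ⟨w₀ * Complex.exp ((θ : ℂ) * Complex.I), ?_, ?_⟩
  · rw [mul_pow, hζm, mul_one, hw₀]
  · rw [hw₀re, Complex.im_ofReal_mul, Complex.exp_ofReal_mul_I_im]
    exact mul_ne_zero hre0 hsin.ne'

/-- **No polynomial pair passes the hexagon Wick test, case `deg F > deg G + 3`.** [folklore] -/
theorem hexagonPencil_noPoly_gt (F G : ℝ[X]) (hG : G ≠ 0) (hgt : G.natDegree + 3 < F.natDegree)
    (hW : WickHexagon (fun z => Polynomial.aeval z F) (fun z => Polynomial.aeval z G)) : False := by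
  classical
  set g := G.natDegree with hg
  set f := F.natDegree with hf
  obtain ⟨m, hm⟩ : ∃ m : ℕ, f = g + m := ⟨f - g, by omega⟩
  have hm4 : 4 ≤ m := by omega
  have hF : F ≠ 0 := by rintro rfl; simp [hf] at hgt
  have hlcF : F.leadingCoeff ≠ 0 := leadingCoeff_ne_zero.2 hF
  have hlcG : G.leadingCoeff ≠ 0 := leadingCoeff_ne_zero.2 hG
  -- the pencil along `s = t^m`, `t = n + 1`
  set Φ : ℕ → ℝ[X] := fun n => F + (X ^ 3 - Polynomial.C (18 * (((n : ℝ) + 1) ^ m)) * X ^ 2 +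
    Polynomial.C (48 * (((n : ℝ) + 1) ^ m) ^ 2) * X - Polynomial.C (32 * (((n : ℝ) + 1) ^ m) ^ 3)) * G with hΦ
  have hdeg : ∀ n, (Φ n).natDegree = f := by
    intro n
    rw [hΦ]; simp only []
    rw [natDegree_add_eq_left_of_natDegree_lt]
    rw [natDegree_pencilMul G hG]; exact hgt
  -- the limit polynomial `lc(F) X^f − 32 lc(G) X^g`
  set q : ℝ[X] := Polynomial.C F.leadingCoeff * X ^ f - Polynomial.C (32 * G.leadingCoeff) * X ^ g with hq
  have hqcoeff : ∀ i, q.coeff i = (if i = f then F.leadingCoeff else 0) - (if i = g then 32 * G.leadingCoeff else 0) := by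
    intro i; rw [hq, coeff_sub, coeff_C_mul_X_pow, coeff_C_mul_X_pow]
  have hqdeg : q.natDegree = f := by
    refine le_antisymm ?_ (le_natDegree_of_ne_zero ?_)
    · rw [hq]
      exact (natDegree_sub_le _ _).trans (max_le (natDegree_C_mul_X_pow_le _ _) ((natDegree_C_mul_X_pow_le _ _).trans (by omega)))
    · rw [hqcoeff, if_pos rfl, if_neg (by omega), sub_zero]; exact hlcF
  have hq0 : q ≠ 0 := by
    intro h; have := hqcoeff f
    rw [h, coeff_zero, if_pos rfl, if_neg (by omega), sub_zero] at this; exact hlcF this.symm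
  -- rescaled roots are real
  have hS : IsClosed {w : ℂ | w.im = 0} := isClosed_eq Complex.continuous_im continuous_const
  have hroots : ∀ (n : ℕ) (z : ℂ), Polynomial.aeval z (Φ n) = 0 →
      (((((n : ℝ) + 1)⁻¹ ^ 3 : ℝ) : ℂ) * z) ∈ {w : ℂ | w.im = 0} := by
    intro n z hz
    rw [hΦ] at hz; simp only [] at hz
    rw [aeval_pencil] at hz
    have him := (hW (((n : ℝ) + 1) ^ m) (by positivity) z hz).1
    rw [Set.mem_setOf_eq, Complex.mul_im, Complex.ofReal_re, Complex.ofReal_im, him]; ring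
  -- coefficient convergence
  have hcoef : ∀ i : ℕ, Tendsto (fun n => (1 : ℝ) * ((Φ n).coeff i * (((n : ℝ) + 1)⁻¹ ^ 3) ^ (f - i))) atTop
      (𝓝 (q.coeff i)) := by
    intro i
    have hform : ∀ n : ℕ, (1 : ℝ) * ((Φ n).coeff i * (((n : ℝ) + 1)⁻¹ ^ 3) ^ (f - i)) =
        F.coeff i * ((n : ℝ) + 1) ^ 0 * (((n : ℝ) + 1)⁻¹) ^ (3 * (f - i)) +
        (X ^ 3 * G).coeff i * ((n : ℝ) + 1) ^ 0 * (((n : ℝ) + 1)⁻¹) ^ (3 * (f - i)) -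
        18 * (X ^ 2 * G).coeff i * ((n : ℝ) + 1) ^ m * (((n : ℝ) + 1)⁻¹) ^ (3 * (f - i)) +
        48 * (X * G).coeff i * ((n : ℝ) + 1) ^ (2 * m) * (((n : ℝ) + 1)⁻¹) ^ (3 * (f - i)) -
        32 * G.coeff i * ((n : ℝ) + 1) ^ (3 * m) * (((n : ℝ) + 1)⁻¹) ^ (3 * (f - i)) := by
      intro n; rw [hΦ]; simp only []; rw [coeff_pencil, ← pow_mul, mul_comm 3 (f - i)]; ring
    simp_rw [hform]
    have hXk : ∀ k : ℕ, (X ^ k * G).coeff i = if k ≤ i then G.coeff (i - k) else 0 := fun k => by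
      rw [coeff_X_pow_mul']
    have hlcg : G.coeff g = G.leadingCoeff := rfl
    have hlcf : F.coeff f = F.leadingCoeff := rfl
    have hA : Tendsto (fun n : ℕ => F.coeff i * ((n : ℝ) + 1) ^ 0 * (((n : ℝ) + 1)⁻¹) ^ (3 * (f - i))) atTop
        (𝓝 (if i = f then F.leadingCoeff else 0)) := by
      by_cases hi : i = f
      · rw [if_pos hi, hi, hlcf, show 3 * (f - f) = 0 by omega]
        exact tendsto_const_nhds.congr fun n => (term_eq _ 0 n).symm
      · rw [if_neg hi]
        by_cases hFi : F.coeff i = 0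
        · simp only [hFi, zero_mul]; exact tendsto_const_nhds
        · have := le_natDegree_of_ne_zero hFi
          exact term_tendsto_zero _ _ _ (by omega)
    have hB : Tendsto (fun n : ℕ => (X ^ 3 * G).coeff i * ((n : ℝ) + 1) ^ 0 * (((n : ℝ) + 1)⁻¹) ^ (3 * (f - i))) atTop
        (𝓝 0) := by
      rw [hXk 3]
      split_ifs with h3
      · by_cases hGi : G.coeff (i - 3) = 0
        · simp only [hGi, zero_mul]; exact tendsto_const_nhds
        · have := le_natDegree_of_ne_zero hGi
          exact term_tendsto_zero _ _ _ (by omega)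
      · simp only [zero_mul]; exact tendsto_const_nhds
    have hC : Tendsto (fun n : ℕ => 18 * (X ^ 2 * G).coeff i * ((n : ℝ) + 1) ^ m * (((n : ℝ) + 1)⁻¹) ^ (3 * (f - i))) atTop
        (𝓝 0) := by
      rw [hXk 2]
      split_ifs with h2
      · by_cases hGi : G.coeff (i - 2) = 0
        · simp only [hGi, mul_zero, zero_mul]; exact tendsto_const_nhds
        · have := le_natDegree_of_ne_zero hGi
          exact term_tendsto_zero _ _ _ (by omega)
      · simp only [mul_zero, zero_mul]; exact tendsto_const_nhds
    have hD : Tendsto (fun n : ℕ => 48 * (X * G).coeff i * ((n : ℝ) + 1) ^ (2 * m) * (((n : ℝ) + 1)⁻¹) ^ (3 * (f - i))) atTop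
        (𝓝 0) := by
      have hX1 : (X * G).coeff i = if 1 ≤ i then G.coeff (i - 1) else 0 := by rw [← pow_one (X : ℝ[X]), hXk 1]
      rw [hX1]
      split_ifs with h1
      · by_cases hGi : G.coeff (i - 1) = 0
        · simp only [hGi, mul_zero, zero_mul]; exact tendsto_const_nhds
        · have := le_natDegree_of_ne_zero hGi
          exact term_tendsto_zero _ _ _ (by omega)
      · simp only [mul_zero, zero_mul]; exact tendsto_const_nhds
    have hE : Tendsto (fun n : ℕ => 32 * G.coeff i * ((n : ℝ) + 1) ^ (3 * m) * (((n : ℝ) + 1)⁻¹) ^ (3 * (f - i))) atTop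
        (𝓝 (if i = g then 32 * G.leadingCoeff else 0)) := by
      by_cases hi : i = g
      · rw [if_pos hi, hi, hlcg, show 3 * (f - g) = 3 * m by omega]
        exact tendsto_const_nhds.congr fun n => (term_eq _ (3 * m) n).symm
      · rw [if_neg hi]
        by_cases hGi : G.coeff i = 0
        · simp only [hGi, mul_zero, zero_mul]; exact tendsto_const_nhds
        · have := le_natDegree_of_ne_zero hGi
          exact term_tendsto_zero _ _ _ (by omega)
    have hsum := (((hA.add hB).sub hC).add hD).sub hE
    rw [add_zero, sub_zero, add_zero] at hsum
    rw [hqcoeff]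
    exact hsum
  have hmem := rescaled_roots_mem Φ f hdeg (fun n => ((n : ℝ) + 1)⁻¹ ^ 3) (fun _ => 1)
    (fun n => pow_ne_zero 3 (inv_ne_zero (by positivity))) (fun _ => one_ne_zero) _ hS hroots q hqdeg hq0 hcoef
  -- a non-real root of `q`
  obtain ⟨w, hwm, hwim⟩ := exists_nonreal_pow_eq m (by omega) (32 * G.leadingCoeff / F.leadingCoeff)
    (div_ne_zero (mul_ne_zero (by norm_num) hlcG) hlcF)
  have hqw : Polynomial.aeval w q = 0 := by
    rw [hq]; simp only [map_sub, map_mul, map_pow, Polynomial.aeval_X, Polynomial.aeval_C, Complex.coe_algebraMap]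
    rw [hm, pow_add, hwm]
    have hlcFC : (F.leadingCoeff : ℂ) ≠ 0 := Complex.ofReal_ne_zero.2 hlcF
    push_cast
    field_simp
    ring
  exact hwim (hmem w hqw)

end Summit.QuantumFields.YangMills.Cruxes.RationalToGeneral.HexagonNormalForm
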